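import Summits.AtomisticToContinuum.BoseEinsteinCondensation.Theorems.BECInsertionCorrectorBoundaryTransferWeakFreeCoupledRelocationCore

/-!
# Crux `BoundaryTransferWeak` (stmt-AtomisticToContinuum-0827), line `Sketch` (coupled-bath-relocation):
# stub `stub_freeCoupledRelocation` (S4) — the free coupled relocation bound

The `v = 0` instance of the line's research stub `CoupledRelocationBound` (v2), assembled from the
free ground-state identification (stub S2b, taken as a hypothesis: `groundState 0 N L = u_L^{⊗N}` a.e.)
and the free torus slice typicality (stub S3, taken as a hypothesis), under the PRODUCT coupling of the
two laws.  Ingredients: the free periodic ground-state energy vanishes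
(`periodicGroundStateEnergy_zero_eq_zero`), so a `δ`-near-minimiser has `periodicEnergy 0 Φ ≤ δ` and S3
applies at tolerance `min(ε,1)/64`; Fubini along the tagged particle (`measurePreserving_vecCons`) turns the
a.e. identification of the ground state into an a.e. identification of its SLICES for almost every bath,
and the bad baths together with the baths leaving the box are `Q`-null; the marginals of `Q ⊗ P` are
`Q, P` because both laws have mass one (`lintegral_groundState_sq_of_ne_top`, `Φ.norm_eq`); on the good
event `{tail Z good} ×ˢ E` the deterministic core `FreeCoupledRelocation.core` supplies every clause of
the good event with `e^M = 3 · e^{(3/2) log 2}`. [folklore]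
-/

noncomputable section

namespace Summit.AtomisticToContinuum.BoseEinsteinCondensation.CoupledBaths

open Literature.MathematicalPhysics.QuantumManyBody.BoseGas MeasureTheory Filter
open scoped ENNReal NNReal
open FreeCoupledRelocation
/-- **Stub S4 — free coupled relocation** (`CoupledBaths.stub_freeCoupledRelocation`, line `Sketch` of
crux stmt-AtomisticToContinuum-0827): the `v = 0` instance of the line's research stub
`CoupledRelocationBound` (v2) from the free ground-state identification (S2b) and the free torus slice
typicality (S3): `ρ₁ = 1`, `M₀ = log (3 · 2^{3/2})`, every `n`, `δ` from S3 at `(min(ε,1)/64, η)` (the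
free periodic ground-state energy vanishes), the PRODUCT coupling `π = Q ⊗ P` of the two laws, good event
`G = {Z : tail Z Fubini-good and in the box} ×ˢ E`; exceptional sets `S = C ∩ (B ∪ N)`, `T = B ∪ N` with
`B` the torus slice's Chebyshev set and `N` the null set where the box slice is not the sine profile.
[folklore] -/
theorem stub_freeCoupledRelocation :
    (∀ (N : ℕ) (L : ℝ), 1 ≤ N → 0 < L →
      groundState 0 N L =ᵐ[volume] fun X => ∏ i : Fin N,
        Set.indicator (box L) (fun x : Space => ∏ k : Fin 3, Real.sqrt (2 / L) * Real.sin (Real.pi * x k / L)) (X i)) →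
    (∀ (n : ℕ) (L : ℝ), 0 < L → ∀ ε : ℝ, 0 < ε → ∀ η : ℝ, 0 < η →
      ∃ δ : ℝ≥0∞, 0 < δ ∧ ∀ Φ : PeriodicTrialState (n + 1) L, periodicEnergy 0 Φ ≤ δ →
        ∃ E : Set (Config (n + 1)), MeasurableSet E ∧
          ((volume.restrict (cellN (n + 1) L)).withDensity (fun W => (‖Φ.ψ W‖₊ : ℝ≥0∞) ^ 2)) Eᶜ ≤
            ENNReal.ofReal η ∧
          ∀ W ∈ E, ∃ μ : ℝ, 0 < μ ∧ ∃ B : Set Space, MeasurableSet B ∧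
            volume B ≤ ENNReal.ofReal (ε * L ^ 3) ∧
            ∫⁻ y in B, ENNReal.ofReal ‖Φ.ψ (Matrix.vecCons y (Matrix.vecTail W))‖ ^ 2 ≤
              ENNReal.ofReal (ε * μ ^ 2 * L ^ 3) ∧
            ∀ y ∈ cell L \ B, μ / 2 ≤ ‖Φ.ψ (Matrix.vecCons y (Matrix.vecTail W))‖ ∧
              ‖Φ.ψ (Matrix.vecCons y (Matrix.vecTail W))‖ ≤ 3 * μ / 2) →
    ∃ ρ₁ : ℝ, 0 < ρ₁ ∧ ∀ ρ : ℝ, 0 < ρ → ρ < ρ₁ →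
    ∀ ε : ℝ, 0 < ε → ∀ η : ℝ, 0 < η → ∃ M : ℝ, ∀ᶠ n : ℕ in atTop,
      groundStateEnergy 0 (n + 1) (sideLength ρ (n + 1)) ≠ ⊤ →
      ∃ δ : ℝ≥0∞, 0 < δ ∧ ∀ Φ : PeriodicTrialState (n + 1) (sideLength ρ (n + 1)),
        periodicEnergy 0 Φ ≤ periodicGroundStateEnergy 0 (n + 1) (sideLength ρ (n + 1)) + δ →
        ∃ π : Measure (Config (n + 1) × Config (n + 1)),
          π.map Prod.fst = volume.withDensity (fun Z => ENNReal.ofReal (groundState 0 (n + 1) (sideLength ρ (n + 1)) Z) ^ 2) ∧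
          π.map Prod.snd = ((volume.restrict (cellN (n + 1) (sideLength ρ (n + 1)))).withDensity fun W => (‖Φ.ψ W‖₊ : ℝ≥0∞) ^ 2) ∧
          ∃ G : Set (Config (n + 1) × Config (n + 1)), MeasurableSet G ∧
            ENNReal.ofReal (1 - η) ≤ π G ∧
            ∀ p ∈ G,
              0 < ∫⁻ x in {x : Space | ∀ t, x t ∈ Set.Ioo (1 / 4 * sideLength ρ (n + 1)) (sideLength ρ (n + 1) - 1 / 4 * sideLength ρ (n + 1))},
                  ENNReal.ofReal (groundState 0 (n + 1) (sideLength ρ (n + 1)) (Matrix.vecCons x (Matrix.vecTail p.1))) ^ 2 ∧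
              ∫⁻ x in {x : Space | ∀ t, x t ∈ Set.Ioo (1 / 4 * sideLength ρ (n + 1)) (sideLength ρ (n + 1) - 1 / 4 * sideLength ρ (n + 1))},
                  ENNReal.ofReal (groundState 0 (n + 1) (sideLength ρ (n + 1)) (Matrix.vecCons x (Matrix.vecTail p.1))) ^ 2 < ⊤ ∧
              ∫⁻ x, ENNReal.ofReal (groundState 0 (n + 1) (sideLength ρ (n + 1)) (Matrix.vecCons x (Matrix.vecTail p.1))) ^ 2 < ⊤ ∧
              ∃ S ⊆ {x : Space | ∀ t, x t ∈ Set.Ioo (1 / 4 * sideLength ρ (n + 1)) (sideLength ρ (n + 1) - 1 / 4 * sideLength ρ (n + 1))},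
                MeasurableSet S ∧
                volume S ≤ ENNReal.ofReal ε * volume {x : Space | ∀ t, x t ∈ Set.Ioo (1 / 4 * sideLength ρ (n + 1)) (sideLength ρ (n + 1) - 1 / 4 * sideLength ρ (n + 1))} ∧
                ∫⁻ x in S, ENNReal.ofReal (groundState 0 (n + 1) (sideLength ρ (n + 1)) (Matrix.vecCons x (Matrix.vecTail p.1))) ^ 2 ≤
                  ENNReal.ofReal ε * ∫⁻ x in {x : Space | ∀ t, x t ∈ Set.Ioo (1 / 4 * sideLength ρ (n + 1)) (sideLength ρ (n + 1) - 1 / 4 * sideLength ρ (n + 1))},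
                    ENNReal.ofReal (groundState 0 (n + 1) (sideLength ρ (n + 1)) (Matrix.vecCons x (Matrix.vecTail p.1))) ^ 2 ∧
                ∫⁻ y in S, ENNReal.ofReal ‖Φ.ψ (Matrix.vecCons y (Matrix.vecTail p.2))‖ ^ 2 ≤
                  ENNReal.ofReal ε * ∫⁻ y in {x : Space | ∀ t, x t ∈ Set.Ioo (1 / 4 * sideLength ρ (n + 1)) (sideLength ρ (n + 1) - 1 / 4 * sideLength ρ (n + 1))},
                    ENNReal.ofReal ‖Φ.ψ (Matrix.vecCons y (Matrix.vecTail p.2))‖ ^ 2 ∧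
                (∀ x ∈ {x : Space | ∀ t, x t ∈ Set.Ioo (1 / 4 * sideLength ρ (n + 1)) (sideLength ρ (n + 1) - 1 / 4 * sideLength ρ (n + 1))} \ S,
                  ∀ y ∈ {x : Space | ∀ t, x t ∈ Set.Ioo (1 / 4 * sideLength ρ (n + 1)) (sideLength ρ (n + 1) - 1 / 4 * sideLength ρ (n + 1))} \ S,
                    groundState 0 (n + 1) (sideLength ρ (n + 1)) (Matrix.vecCons x (Matrix.vecTail p.1)) * ‖Φ.ψ (Matrix.vecCons y (Matrix.vecTail p.2))‖ ≤
                      Real.exp M * (groundState 0 (n + 1) (sideLength ρ (n + 1)) (Matrix.vecCons y (Matrix.vecTail p.1)) * ‖Φ.ψ (Matrix.vecCons x (Matrix.vecTail p.2))‖)) ∧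
                ∃ T : Set Space, MeasurableSet T ∧
                  ∫⁻ y in T, ENNReal.ofReal (groundState 0 (n + 1) (sideLength ρ (n + 1)) (Matrix.vecCons y (Matrix.vecTail p.1))) ^ 2 ≤
                    ENNReal.ofReal ε * ∫⁻ x, ENNReal.ofReal (groundState 0 (n + 1) (sideLength ρ (n + 1)) (Matrix.vecCons x (Matrix.vecTail p.1))) ^ 2 ∧
                  ∀ x ∈ {x : Space | ∀ t, x t ∈ Set.Ioo (1 / 4 * sideLength ρ (n + 1)) (sideLength ρ (n + 1) - 1 / 4 * sideLength ρ (n + 1))} \ S,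
                    ∀ y ∈ (cell (sideLength ρ (n + 1)) \ {x : Space | ∀ t, x t ∈ Set.Ioo (1 / 4 * sideLength ρ (n + 1)) (sideLength ρ (n + 1) - 1 / 4 * sideLength ρ (n + 1))}) \ T,
                      groundState 0 (n + 1) (sideLength ρ (n + 1)) (Matrix.vecCons y (Matrix.vecTail p.1)) * ‖Φ.ψ (Matrix.vecCons x (Matrix.vecTail p.2))‖ ≤
                        Real.exp M * (groundState 0 (n + 1) (sideLength ρ (n + 1)) (Matrix.vecCons x (Matrix.vecTail p.1)) * ‖Φ.ψ (Matrix.vecCons y (Matrix.vecTail p.2))‖) := by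
  intro hGS hTS
  refine ⟨1, one_pos, fun ρ hρ _ ε hε η hη => ?_⟩
  refine ⟨Real.log (3 * Real.exp (3 / 2 * Real.log 2)), Filter.Eventually.of_forall fun n hE => ?_⟩
  -- the box side, the tolerance handed to S3, the slack
  set L : ℝ := sideLength ρ (n + 1) with hLdef
  have hL : 0 < L := by
    rw [hLdef]
    unfold sideLength
    exact Real.rpow_pos_of_pos (div_pos (Nat.cast_pos.mpr (Nat.succ_pos n)) hρ) _
  set ε₁ : ℝ := min ε 1 / 64 with hε₁def
  have hmin : 0 < min ε 1 := lt_min hε one_pos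
  have hε₁0 : 0 < ε₁ := by positivity
  have hε₁ε : ε₁ ≤ ε / 64 := by
    rw [hε₁def]
    exact div_le_div_of_nonneg_right (min_le_left _ _) (by norm_num)
  have hε₁1 : ε₁ ≤ 1 / 64 := by
    rw [hε₁def]
    exact div_le_div_of_nonneg_right (min_le_right _ _) (by norm_num)
  obtain ⟨δ, hδ, hΦall⟩ := hTS n L hL ε₁ hε₁0 η hη
  refine ⟨δ, hδ, fun Φ hΦE => ?_⟩
  have hper : periodicEnergy 0 Φ ≤ δ := by
    have h := hΦE
    rwa [periodicGroundStateEnergy_zero_eq_zero (n + 1) hL, zero_add] at h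
  obtain ⟨E, hEm, hEc, hEgood⟩ := hΦall Φ hper
  -- the sine mode, the ground state, and the identification (S2b)
  set u : Space → ℝ := Set.indicator (box L)
    (fun x : Space => ∏ k : Fin 3, Real.sqrt (2 / L) * Real.sin (Real.pi * x k / L)) with hudef
  set gs : Config (n + 1) → ℝ := groundState 0 (n + 1) L with hgsdef
  have hGS' : gs =ᵐ[volume] fun X => ∏ i, u (X i) := hGS (n + 1) L (by omega) hL
  -- Fubini: for a.e. bath `V`, the slice of `gs` at `V` is `u · ∏ᵢ u(Vᵢ)` a.e.
  have hslice : ∀ᵐ V : Config n, ∀ᵐ x : Space, gs (Matrix.vecCons x V) = u x * ∏ i, u (V i) := by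
    have h1 : (gs ∘ fun p : Space × Config n => Matrix.vecCons p.1 p.2) =ᵐ[volume.prod volume]
        ((fun X : Config (n + 1) => ∏ i, u (X i)) ∘ fun p : Space × Config n => Matrix.vecCons p.1 p.2) :=
      (measurePreserving_vecCons (n := n)).quasiMeasurePreserving.ae_eq hGS'
    have h2 := (Measure.measurePreserving_swap (μ := (volume : Measure (Config n)))
      (ν := (volume : Measure Space))).quasiMeasurePreserving.ae_eq h1
    filter_upwards [Measure.ae_ae_of_ae_prod h2] with V hV
    filter_upwards [hV] with x hx
    simp only [Function.comp_apply, Prod.swap_prod_mk] at hx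
    rw [hx, Fin.prod_univ_succ]
    simp
  obtain ⟨N₀, hN₀sub, hN₀m, hN₀vol⟩ := exists_measurable_superset_of_null (ae_iff.1 hslice)
  -- the good baths: Fubini-good and inside the box
  have hboxm : MeasurableSet {Z : Config (n + 1) | ∀ i, Matrix.vecTail Z i ∈ box L} := by
    have : {Z : Config (n + 1) | ∀ i, Matrix.vecTail Z i ∈ box L} =
        ⋂ i : Fin n, (fun Z : Config (n + 1) => Z i.succ) ⁻¹' box L := by
      ext Z
      simp [Matrix.vecTail]
    rw [this]
    exact MeasurableSet.iInter fun i => (measurableSet_box L).preimage (measurable_pi_apply _)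
  set A : Set (Config (n + 1)) :=
    {Z | Matrix.vecTail Z ∉ N₀} ∩ {Z | ∀ i, Matrix.vecTail Z i ∈ box L} with hAdef
  have hAm : MeasurableSet A := (measurable_vecTail hN₀m).compl.inter hboxm
  -- the two laws
  set Q : Measure (Config (n + 1)) := volume.withDensity fun Z => ENNReal.ofReal (gs Z) ^ 2 with hQdef
  set P : Measure (Config (n + 1)) :=
    (volume.restrict (cellN (n + 1) L)).withDensity fun W => (‖Φ.ψ W‖₊ : ℝ≥0∞) ^ 2 with hPdef
  have hQ1 : Q Set.univ = 1 := by
    rw [hQdef, withDensity_apply _ MeasurableSet.univ, Measure.restrict_univ]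
    exact Summit.AtomisticToContinuum.BoseEinsteinCondensation.Theorems.BECInsertionVariance.lintegral_groundState_sq_of_ne_top hE
  have hP1 : P Set.univ = 1 := by
    rw [hPdef, withDensity_apply _ MeasurableSet.univ, Measure.restrict_univ]
    exact Φ.norm_eq
  haveI : IsProbabilityMeasure Q := ⟨hQ1⟩
  haveI : IsProbabilityMeasure P := ⟨hP1⟩
  -- `Q` charges only good baths
  have hQA : Q Aᶜ = 0 := by
    have hv1 : volume {Z : Config (n + 1) | Matrix.vecTail Z ∈ N₀} = 0 := by
      have hmeas : MeasurableSet {Z : Config (n + 1) | Matrix.vecTail Z ∈ N₀} :=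
        measurable_vecTail hN₀m
      rw [← (measurePreserving_vecCons (n := n)).measure_preimage hmeas.nullMeasurableSet]
      have : (fun p : Space × Config n => Matrix.vecCons p.1 p.2) ⁻¹'
          {Z : Config (n + 1) | Matrix.vecTail Z ∈ N₀} = Set.univ ×ˢ N₀ := by
        ext p
        simp [Matrix.tail_cons]
      rw [this, Measure.prod_prod, hN₀vol, mul_zero]
    have h1 : Q {Z : Config (n + 1) | Matrix.vecTail Z ∈ N₀} = 0 :=
      withDensity_absolutelyContinuous _ _ hv1
    have hQeq : Q = volume.withDensity fun Z => ENNReal.ofReal (∏ i, u (Z i)) ^ 2 := by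
      rw [hQdef]
      refine withDensity_congr_ae ?_
      filter_upwards [hGS'] with Z hZ
      rw [hZ]
    have h2 : Q {Z : Config (n + 1) | ∀ i, Matrix.vecTail Z i ∈ box L}ᶜ = 0 := by
      rw [hQeq, withDensity_apply _ hboxm.compl]
      refine (setLIntegral_congr_fun hboxm.compl (g := fun _ => 0) fun Z hZ => ?_).trans
        lintegral_zero
      simp only [Set.mem_compl_iff, Set.mem_setOf_eq, not_forall] at hZ
      obtain ⟨i, hi⟩ := hZ
      have : u (Z i.succ) = 0 := by
        rw [hudef, Set.indicator_of_notMem]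
        simpa [Matrix.vecTail] using hi
      rw [Finset.prod_eq_zero (Finset.mem_univ i.succ) this]
      simp
    have hsplit : Aᶜ ⊆ {Z : Config (n + 1) | Matrix.vecTail Z ∈ N₀} ∪
        {Z : Config (n + 1) | ∀ i, Matrix.vecTail Z i ∈ box L}ᶜ := by
      intro Z hZ
      rw [hAdef, Set.compl_inter] at hZ
      rcases hZ with h | h
      · left
        simpa using h
      · exact Or.inr h
    exact measure_mono_null hsplit (measure_union_null h1 h2)
  have hQAeq : Q A = 1 := by
    have h := measure_add_measure_compl (μ := Q) hAm
    rwa [hQA, add_zero, hQ1] at h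
  have hPE : ENNReal.ofReal (1 - η) ≤ P E := by
    have hc : P E = 1 - P Eᶜ := by
      have h := prob_compl_eq_one_sub (μ := P) hEm.compl
      rwa [compl_compl] at h
    rw [hc, ENNReal.ofReal_sub _ hη.le, ENNReal.ofReal_one]
    exact tsub_le_tsub_left hEc 1
  refine ⟨Q.prod P, Measure.fst_prod, Measure.snd_prod, A ×ˢ E, hAm.prod hEm, ?_, ?_⟩
  · rw [Measure.prod_prod, hQAeq, one_mul]
    exact hPE
  rintro ⟨Z, W⟩ ⟨hZ, hW⟩
  obtain ⟨hZN, hZbox⟩ := hZ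
  -- the good bath of the box configuration
  have hVgood : ∀ᵐ x : Space, gs (Matrix.vecCons x (Matrix.vecTail Z)) =
      u x * ∏ i, u (Matrix.vecTail Z i) := by
    by_contra hbad
    exact hZN (hN₀sub hbad)
  have hcV : 0 < ∏ i, u (Matrix.vecTail Z i) :=
    Finset.prod_pos fun i _ => indicator_sineMode_pos hL (hZbox i)
  obtain ⟨μ, hμ, B, hBm, hBvol, hBφ, hband⟩ := hEgood W hW
  -- inputs of the deterministic core
  have hψm : Measurable fun x : Space => gs (Matrix.vecCons x (Matrix.vecTail Z)) :=
    (measurable_groundState 0 (n + 1) L).comp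
      (measurable_vecCons.comp (measurable_id.prodMk measurable_const))
  have hum : Measurable u := measurable_indicator_sineMode L
  have hgm : Measurable fun x : Space => u x * ∏ i, u (Matrix.vecTail Z i) := hum.mul_const _
  have hg0 : ∀ x, 0 ≤ u x * ∏ i, u (Matrix.vecTail Z i) := fun x =>
    mul_nonneg (indicator_sineMode_nonneg hL x) hcV.le
  have hφ0 : ∀ y, 0 ≤ ‖Φ.ψ (Matrix.vecCons y (Matrix.vecTail W))‖ := fun y => norm_nonneg _
  have hK : 0 < Real.exp (3 / 2 * Real.log 2) := Real.exp_pos _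
  have hgK : ∀ x ∈ {x : Space | ∀ t, x t ∈ Set.Ioo (1 / 4 * L) (L - 1 / 4 * L)}, ∀ y,
      u y * ∏ i, u (Matrix.vecTail Z i) ≤
        Real.exp (3 / 2 * Real.log 2) * (u x * ∏ i, u (Matrix.vecTail Z i)) := by
    intro x hx y
    calc u y * ∏ i, u (Matrix.vecTail Z i)
        ≤ (Real.exp (3 / 2 * Real.log 2) * u x) * ∏ i, u (Matrix.vecTail Z i) :=
          mul_le_mul_of_nonneg_right (indicator_sineMode_le hL hx y) hcV.le
      _ = _ := by ring
  have hm₀ : 0 < (∏ i, u (Matrix.vecTail Z i)) ^ 2 / L ^ 3 := by positivity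
  have hgC : ∀ x ∈ {x : Space | ∀ t, x t ∈ Set.Ioo (1 / 4 * L) (L - 1 / 4 * L)},
      (∏ i, u (Matrix.vecTail Z i)) ^ 2 / L ^ 3 ≤ (u x * ∏ i, u (Matrix.vecTail Z i)) ^ 2 := by
    intro x hx
    have h := le_indicator_sineMode_sq hL hx
    calc (∏ i, u (Matrix.vecTail Z i)) ^ 2 / L ^ 3 = 1 / L ^ 3 * (∏ i, u (Matrix.vecTail Z i)) ^ 2 := by
          ring
      _ ≤ u x ^ 2 * (∏ i, u (Matrix.vecTail Z i)) ^ 2 := by gcongr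
      _ = _ := by ring
  have hg8 : ∀ y, (u y * ∏ i, u (Matrix.vecTail Z i)) ^ 2 ≤
      8 * ((∏ i, u (Matrix.vecTail Z i)) ^ 2 / L ^ 3) := by
    intro y
    have h := indicator_sineMode_sq_le hL y
    calc (u y * ∏ i, u (Matrix.vecTail Z i)) ^ 2 = u y ^ 2 * (∏ i, u (Matrix.vecTail Z i)) ^ 2 := by
          ring
      _ ≤ 8 / L ^ 3 * (∏ i, u (Matrix.vecTail Z i)) ^ 2 := by gcongr
      _ = _ := by ring
  have hgsupp : ∀ y, y ∉ box L → u y * ∏ i, u (Matrix.vecTail Z i) = 0 := fun y hy => by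
    rw [hudef, Set.indicator_of_notMem hy, zero_mul]
  exact core hL hε hε₁0.le hε₁ε hε₁1 hK hm₀ hμ hψm hgm hg0 hφ0 hVgood hgK hgC hg8 hgsupp hBm hBvol
    hBφ hband

end Summit.AtomisticToContinuum.BoseEinsteinCondensation.CoupledBaths

end
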